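import Summits.CriticalPhenomena.Ising3DConformalLimit.Theses.FKParityRobustness
import Summits.CriticalPhenomena.Ising3DConformalLimit.Theorems.FKParityRobustnessShadowGivesJoin
import Literature.Probability.LatticeModels.GKSInequalities
import Literature.Probability.LatticeModels.ModifiedSimonInequality
import Literature.Combinatorics.SimpleGraph.CycleSpaceSeparators
import HarnessLib

/-!
# Crux IndependentStrandsJoin (stmt-CriticalPhenomena-14625), line Sketch — stub `stub_separation`

Route `FKParityRobustness`, sub-problem `Ising3DConformalLimit`.  On a finite graph `G` with
`t = tanh β` (`β ≥ 0`), `Z^B = loopO1PartitionFunction G t B`, `𝒯(B) = tJoins G univ B` and four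
marked vertices `a`, write

* `meetSum = Σ_{F₁ ∈ 𝒯(a₀a₁)} Σ_{F₂ ∈ 𝒯(a₂a₃)} t^{|F₁|+|F₂|} 1[∃ v, a₀ ↝_{F₁} v ∧ a₂ ↝_{F₂} v]`,
* `sepSum = Σ_{D ∈ 𝒯(a₀a₁a₂a₃), a₀ ↝̸_D a₂, a₀ ↝̸_D a₃} t^{|D|}`.

The stub: the route lever `DepletionBound` (item 14628) and the pair-split deletion identity (★)
`Σ_{F₁ ∈ 𝒯(a₀a₁) clean} t^{|F₁|} ⟨σ_{a₂}σ_{a₃}⟩^free_{G ∖ K_{a₀}(F₁)} = sepSum` imply the SEPARATION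
BOUND `Z^{01} Z^{23} − meetSum ≤ sepSum · Z^∅`.

Proof (the template is `strandsJoin_of_shadow_of_depletion`).  `Z^{01} Z^{23} − meetSum =
Σ_{F₁} (t^{|F₁|} Z^{23} − meet(F₁))`.  Fix `F₁ ∈ 𝒯(a₀a₁)` with `a₀`-cluster `S`.
* If `a₂ ∈ S` or `a₃ ∈ S`, every `F₂ ∈ 𝒯(a₂a₃)` meets `F₁` (at `a₂`, resp. at `a₃`, which `F₂`
  joins to `a₂`: a `T`-join of a pair joins its pair), so `meet(F₁) = t^{|F₁|} Z^{23}` and the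
  term is `0`.
* Otherwise `S ∌ a₂, a₃` and every `F₂` whose `a₂`-cluster touches `S` meets `F₁`, so
  `t^{|F₁|} Z^{23} − meet(F₁) ≤ t^{|F₁|} Avoid(S)`, where
  `Avoid(S) = Σ_{F₂, K_{a₂}(F₂) ∩ S = ∅} t^{|F₂|}`; the depletion bound at `(a₂, a₃, S)` reads
  `Avoid(S) · g ≤ Z^{23} · D(F₁)` with `g = ⟨σ_{a₂}σ_{a₃}⟩^free_G = Z^{23}/Z^∅` and
  `D(F₁) = ⟨σ_{a₂}σ_{a₃}⟩^free_{G ∖ S} ≥ 0` (GKS I), whence `Avoid(S) ≤ D(F₁) · Z^∅`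
  (divide by `g > 0`; if `Z^{23} = 0` then `Avoid(S) ≤ Z^{23} = 0`).
Summing with the weights `t^{|F₁|} ≥ 0` gives
`Z^{01} Z^{23} − meetSum ≤ Z^∅ Σ_{F₁ clean} t^{|F₁|} D(F₁)`, which is `sepSum · Z^∅` by (★).

Theorem-only file.  References: M. Aizenman, Comm. Math. Phys. 86 (1982), Lemma 9.3;
M. Aizenman, R. Fernández, J. Stat. Phys. 44 (1986), Claim (4.15);
U. T. Hansen, J. Jiang, F. R. Klausen, arXiv:2506.10765, §2.
-/

noncomputable section

open Finset SimpleGraph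
open Literature.Probability.LatticeModels
open Summit.CriticalPhenomena.Ising3DConformalLimit.Theses.FKParityRobustness
open scoped Classical BigOperators

namespace Summit.CriticalPhenomena.Ising3DConformalLimit.Theorems

namespace StubSeparation

variable {V : Type*} [Fintype V] [DecidableEq V] (G : SimpleGraph V) [DecidableRel G.Adj]

/-- **The finite-graph core of the separation bound.**  For `β ≥ 0`, `t = tanh β` and four vertices
`a`, the depletion bound for the pair `a₂a₃` (hypothesis `hD`, all `S ∌ a₂, a₃`) and the pair-split
identity (★) for `a` (hypothesis `hS`) give
`Z(a₀a₁) · Z(a₂a₃) − meetSum ≤ sepSum · Z(∅)`. -/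
theorem separation_core {β : ℝ} (hβ : 0 ≤ β) (a : Fin 4 → V)
    (hD : ∀ S : Finset V, a 2 ∉ S → a 3 ∉ S →
      (∑ F ∈ (tJoins G Set.univ {a 2, a 3}).filter (fun F : Finset (Sym2 V) =>
          ∀ v ∈ S, ¬ (SimpleGraph.fromEdgeSet (↑F : Set (Sym2 V))).Reachable (a 2) v),
          Real.tanh β ^ F.card) * isingCorr G Finset.univ β 0 .free {a 2, a 3} ≤
        loopO1PartitionFunction G (Real.tanh β) {a 2, a 3} *
          isingCorr G (Finset.univ \ S) β 0 .free {a 2, a 3})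
    (hS : ∑ F ∈ (tJoins G Set.univ {a 0, a 1}).filter (fun F : Finset (Sym2 V) =>
            ¬ (SimpleGraph.fromEdgeSet (↑F : Set (Sym2 V))).Reachable (a 0) (a 2) ∧
            ¬ (SimpleGraph.fromEdgeSet (↑F : Set (Sym2 V))).Reachable (a 0) (a 3)),
          Real.tanh β ^ F.card *
            isingCorr G (Finset.univ.filter (fun v : V =>
              ¬ (SimpleGraph.fromEdgeSet (↑F : Set (Sym2 V))).Reachable (a 0) v)) β 0 .free
              {a 2, a 3}
        = ∑ D ∈ (tJoins G Set.univ (Finset.univ.image a)).filter (fun D : Finset (Sym2 V) =>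
            ¬ (SimpleGraph.fromEdgeSet (↑D : Set (Sym2 V))).Reachable (a 0) (a 2) ∧
            ¬ (SimpleGraph.fromEdgeSet (↑D : Set (Sym2 V))).Reachable (a 0) (a 3)),
          Real.tanh β ^ D.card) :
    loopO1PartitionFunction G (Real.tanh β) {a 0, a 1} *
          loopO1PartitionFunction G (Real.tanh β) {a 2, a 3}
        - (∑ F₁ ∈ tJoins G Set.univ {a 0, a 1}, ∑ F₂ ∈ tJoins G Set.univ {a 2, a 3},
            if ∃ v : V, (SimpleGraph.fromEdgeSet (↑F₁ : Set (Sym2 V))).Reachable (a 0) v ∧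
                (SimpleGraph.fromEdgeSet (↑F₂ : Set (Sym2 V))).Reachable (a 2) v
            then Real.tanh β ^ (F₁.card + F₂.card) else 0)
      ≤ (∑ D ∈ (tJoins G Set.univ (Finset.univ.image a)).filter (fun D : Finset (Sym2 V) =>
            ¬ (SimpleGraph.fromEdgeSet (↑D : Set (Sym2 V))).Reachable (a 0) (a 2) ∧
            ¬ (SimpleGraph.fromEdgeSet (↑D : Set (Sym2 V))).Reachable (a 0) (a 3)),
            Real.tanh β ^ D.card) * loopO1PartitionFunction G (Real.tanh β) ∅ := by
  -- adapted from `strandsJoin_of_shadow_of_depletion`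
  -- (Theorems/FKParityRobustnessShadowGivesJoin.lean)
  rw [← hS]
  set t : ℝ := Real.tanh β with ht_def
  set T₁ := tJoins G Set.univ {a 0, a 1} with hT₁_def
  set T₂ := tJoins G Set.univ {a 2, a 3} with hT₂_def
  set Z₁ := loopO1PartitionFunction G t {a 0, a 1} with hZ₁_def
  set Z₂ := loopO1PartitionFunction G t {a 2, a 3} with hZ₂_def
  set Z₀ := loopO1PartitionFunction G t ∅ with hZ₀_def
  set g : ℝ := isingCorr G Finset.univ β 0 .free {a 2, a 3} with hg_def
  have ht : 0 ≤ t := by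
    rw [ht_def, Real.tanh_eq_sinh_div_cosh]
    exact div_nonneg (Real.sinh_nonneg_iff.2 hβ) (Real.cosh_pos _).le
  have hZ₁ : Z₁ = ∑ F ∈ T₁, t ^ #F := loopO1PartitionFunction_eq_sum_tJoins G t _
  have hZ₂ : Z₂ = ∑ F ∈ T₂, t ^ #F := loopO1PartitionFunction_eq_sum_tJoins G t _
  have hZ₂nn : 0 ≤ Z₂ := loopO1PartitionFunction_nonneg G ht _
  have hZ₀pos : 0 < Z₀ := loopO1PartitionFunction_empty_pos G ht
  have hgq : g = Z₂ / Z₀ := isingCorr_univ_free_eq_loopO1_div G β _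
  -- the meeting sum of one strand configuration and the depleted correlation
  set meet : Finset (Sym2 V) → ℝ := fun F₁ => ∑ F₂ ∈ T₂,
      if ∃ v : V, (SimpleGraph.fromEdgeSet (↑F₁ : Set (Sym2 V))).Reachable (a 0) v ∧
          (SimpleGraph.fromEdgeSet (↑F₂ : Set (Sym2 V))).Reachable (a 2) v
      then t ^ (#F₁ + #F₂) else 0 with hmeet_def
  set D : Finset (Sym2 V) → ℝ := fun F₁ => isingCorr G (Finset.univ.filter (fun v : V =>
      ¬ (SimpleGraph.fromEdgeSet (↑F₁ : Set (Sym2 V))).Reachable (a 0) v)) β 0 .free {a 2, a 3}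
    with hD_def
  -- (**) the per-configuration inequality
  have key : ∀ F₁ ∈ T₁, t ^ #F₁ * Z₂ - meet F₁ ≤
      (if ¬ (SimpleGraph.fromEdgeSet (↑F₁ : Set (Sym2 V))).Reachable (a 0) (a 2) ∧
            ¬ (SimpleGraph.fromEdgeSet (↑F₁ : Set (Sym2 V))).Reachable (a 0) (a 3)
        then t ^ #F₁ * D F₁ else 0) * Z₀ := by
    intro F₁ _
    have hDnn : 0 ≤ D F₁ := isingCorr_free_nonneg G _ hβ le_rfl _
    by_cases hA : ¬ (SimpleGraph.fromEdgeSet (↑F₁ : Set (Sym2 V))).Reachable (a 0) (a 2) ∧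
        ¬ (SimpleGraph.fromEdgeSet (↑F₁ : Set (Sym2 V))).Reachable (a 0) (a 3)
    · -- clean configuration: the `a₀`-cluster `S` avoids `a₂, a₃`; depletion bound with this `S`
      rw [if_pos hA]
      obtain ⟨h2, h3⟩ := hA
      set S : Finset V := Finset.univ.filter (fun v : V =>
        (SimpleGraph.fromEdgeSet (↑F₁ : Set (Sym2 V))).Reachable (a 0) v) with hS_def
      have h2S : a 2 ∉ S := by simp [hS_def, h2]
      have h3S : a 3 ∉ S := by simp [hS_def, h3]
      have hcompl : Finset.univ \ S = Finset.univ.filter (fun v : V =>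
          ¬ (SimpleGraph.fromEdgeSet (↑F₁ : Set (Sym2 V))).Reachable (a 0) v) := by
        ext v
        simp [hS_def]
      have hDS := hD S h2S h3S
      rw [hcompl] at hDS
      -- `hDS : Avoid * g ≤ Z₂ * D F₁`
      set avoid : Finset (Sym2 V) → Prop := fun F =>
        ∀ v ∈ S, ¬ (SimpleGraph.fromEdgeSet (↑F : Set (Sym2 V))).Reachable (a 2) v with havoid_def
      have hsplit := Finset.sum_filter_add_sum_filter_not T₂ avoid (fun F => t ^ #F)
      have hnavoidnn : 0 ≤ ∑ F ∈ T₂.filter (fun F => ¬ avoid F), t ^ #F :=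
        Finset.sum_nonneg fun F _ => pow_nonneg ht _
      -- every non-avoiding `F₂` meets the `a₀`-cluster of `F₁`
      have hmeetge : t ^ #F₁ * ∑ F ∈ T₂.filter (fun F => ¬ avoid F), t ^ #F ≤ meet F₁ := by
        rw [Finset.mul_sum]
        calc ∑ F ∈ T₂.filter (fun F => ¬ avoid F), t ^ #F₁ * t ^ #F
            = ∑ F ∈ T₂.filter (fun F => ¬ avoid F),
                (if ∃ v : V, (SimpleGraph.fromEdgeSet (↑F₁ : Set (Sym2 V))).Reachable (a 0) v ∧
                    (SimpleGraph.fromEdgeSet (↑F : Set (Sym2 V))).Reachable (a 2) v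
                  then t ^ (#F₁ + #F) else 0) := by
              refine Finset.sum_congr rfl fun F hF => ?_
              have hna : ¬ avoid F := (Finset.mem_filter.1 hF).2
              simp only [havoid_def, not_forall, not_not] at hna
              obtain ⟨v, hv, hreach⟩ := hna
              have hv' : (SimpleGraph.fromEdgeSet (↑F₁ : Set (Sym2 V))).Reachable (a 0) v := by
                simpa [hS_def] using hv
              rw [if_pos ⟨v, hv', hreach⟩, pow_add]
          _ ≤ meet F₁ := by
              simp only [hmeet_def]
              refine Finset.sum_le_sum_of_subset_of_nonneg (Finset.filter_subset _ _) ?_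
              intro F _ _
              split_ifs
              · exact pow_nonneg ht _
              · exact le_rfl
      -- `Avoid ≤ D F₁ * Z₀` from the depletion bound
      have hAv : ∑ F ∈ T₂.filter avoid, t ^ #F ≤ D F₁ * Z₀ := by
        by_cases hZ₂0 : Z₂ = 0
        · have hle : ∑ F ∈ T₂.filter avoid, t ^ #F ≤ Z₂ := by linarith [hsplit, hnavoidnn, hZ₂]
          rw [hZ₂0] at hle
          exact hle.trans (mul_nonneg hDnn hZ₀pos.le)
        · have hZ₂pos : 0 < Z₂ := lt_of_le_of_ne hZ₂nn (Ne.symm hZ₂0)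
          have hgpos : 0 < g := by
            rw [hgq]
            exact div_pos hZ₂pos hZ₀pos
          have hZ₂eq : Z₂ = g * Z₀ := by
            rw [hgq]
            field_simp
          have h3 : Z₂ * D F₁ = D F₁ * Z₀ * g := by
            rw [hZ₂eq]
            ring
          exact le_of_mul_le_mul_right (hDS.trans_eq h3) hgpos
      have h1 : t ^ #F₁ * Z₂ - meet F₁ ≤ t ^ #F₁ * ∑ F ∈ T₂.filter avoid, t ^ #F := by
        have h4 : t ^ #F₁ * Z₂ = t ^ #F₁ * ∑ F ∈ T₂.filter avoid, t ^ #F +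
            t ^ #F₁ * ∑ F ∈ T₂.filter (fun F => ¬ avoid F), t ^ #F := by
          rw [← mul_add, hsplit, hZ₂]
        linarith [hmeetge, h4]
      calc t ^ #F₁ * Z₂ - meet F₁ ≤ t ^ #F₁ * ∑ F ∈ T₂.filter avoid, t ^ #F := h1
        _ ≤ t ^ #F₁ * (D F₁ * Z₀) := mul_le_mul_of_nonneg_left hAv (pow_nonneg ht _)
        _ = t ^ #F₁ * D F₁ * Z₀ := by ring
    · -- sure meeting: `a₂`, or `a₃` (joined to `a₂` by `F₂`), lies in the `a₀`-cluster of `F₁`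
      rw [if_neg hA, zero_mul]
      have hA' : (SimpleGraph.fromEdgeSet (↑F₁ : Set (Sym2 V))).Reachable (a 0) (a 2) ∨
          (SimpleGraph.fromEdgeSet (↑F₁ : Set (Sym2 V))).Reachable (a 0) (a 3) := by
        by_contra hcon
        exact hA (not_or.1 hcon)
      have hmeeteq : meet F₁ = t ^ #F₁ * Z₂ := by
        simp only [hmeet_def]
        rw [hZ₂, Finset.mul_sum]
        refine Finset.sum_congr rfl fun F₂ hF₂ => ?_
        have hc : ∃ v : V, (SimpleGraph.fromEdgeSet (↑F₁ : Set (Sym2 V))).Reachable (a 0) v ∧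
            (SimpleGraph.fromEdgeSet (↑F₂ : Set (Sym2 V))).Reachable (a 2) v := by
          rcases hA' with h | h
          · exact ⟨a 2, h, Reachable.refl _⟩
          · exact ⟨a 3, h, reachable_of_mem_tJoins_pair G hF₂⟩
        rw [if_pos hc, pow_add]
      linarith [hmeeteq]
  -- sum (**) over the strand configurations
  have hsum := Finset.sum_le_sum key
  have hL : ∑ F₁ ∈ T₁, (t ^ #F₁ * Z₂ - meet F₁) = Z₁ * Z₂ - ∑ F₁ ∈ T₁, meet F₁ := by
    rw [Finset.sum_sub_distrib, hZ₁, Finset.sum_mul]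
  have hR : ∑ F₁ ∈ T₁, (if ¬ (SimpleGraph.fromEdgeSet (↑F₁ : Set (Sym2 V))).Reachable (a 0) (a 2) ∧
        ¬ (SimpleGraph.fromEdgeSet (↑F₁ : Set (Sym2 V))).Reachable (a 0) (a 3)
        then t ^ #F₁ * D F₁ else 0) * Z₀ =
      (∑ F₁ ∈ T₁.filter (fun F₁ : Finset (Sym2 V) =>
          ¬ (SimpleGraph.fromEdgeSet (↑F₁ : Set (Sym2 V))).Reachable (a 0) (a 2) ∧
          ¬ (SimpleGraph.fromEdgeSet (↑F₁ : Set (Sym2 V))).Reachable (a 0) (a 3)),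
          t ^ #F₁ * D F₁) * Z₀ := by
    rw [Finset.sum_filter, Finset.sum_mul]
  rw [hL, hR] at hsum
  exact hsum

end StubSeparation

/-- **Stub 3 of the line `Sketch` of `IndependentStrandsJoin` (separation glue).**  From the
depletion bound (route decl `DepletionBound`, item 14628) and the pair-split deletion identity (★):
`Z^{01} Z^{23} − meetSum ≤ sepSum · Z^∅` on every finite graph, `β ≥ 0`, `a` injective.
Per `F₁`: if `a₂` or `a₃` is in the `a₀`-cluster every `F₂` meets it (a `T`-join of a pair joins its
pair); otherwise the non-meeting `F₂` avoid `S = V(K_{a₀}F₁) ∌ a₂, a₃`, the depletion bound gives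
`Avoid(S) ≤ Z^∅ ⟨σ₂σ₃⟩_{G∖S}` (divide by `⟨σ₂σ₃⟩_G = Z^{23}/Z^∅`, or `Z^{23} = 0`), and (★) sums it
(`StubSeparation.separation_core`). -/
theorem stub_separation :
    DepletionBound →
    (∀ (V : Type) [Fintype V] [DecidableEq V] (G : SimpleGraph V) [DecidableRel G.Adj] (β : ℝ),
      0 ≤ β → ∀ a : Fin 4 → V, Function.Injective a →
      (∑ F ∈ (tJoins G Set.univ {a 0, a 1}).filter (fun F : Finset (Sym2 V) =>
            ¬ (SimpleGraph.fromEdgeSet (↑F : Set (Sym2 V))).Reachable (a 0) (a 2) ∧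
            ¬ (SimpleGraph.fromEdgeSet (↑F : Set (Sym2 V))).Reachable (a 0) (a 3)),
          Real.tanh β ^ F.card *
            isingCorr G (Finset.univ.filter (fun v : V =>
              ¬ (SimpleGraph.fromEdgeSet (↑F : Set (Sym2 V))).Reachable (a 0) v)) β 0 .free {a 2, a 3})
        = ∑ D ∈ (tJoins G Set.univ (Finset.univ.image a)).filter (fun D : Finset (Sym2 V) =>
            ¬ (SimpleGraph.fromEdgeSet (↑D : Set (Sym2 V))).Reachable (a 0) (a 2) ∧
            ¬ (SimpleGraph.fromEdgeSet (↑D : Set (Sym2 V))).Reachable (a 0) (a 3)),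
          Real.tanh β ^ D.card) →
    ∀ (V : Type) [Fintype V] [DecidableEq V] (G : SimpleGraph V) [DecidableRel G.Adj] (β : ℝ),
      0 ≤ β → ∀ a : Fin 4 → V, Function.Injective a →
      loopO1PartitionFunction G (Real.tanh β) {a 0, a 1} * loopO1PartitionFunction G (Real.tanh β) {a 2, a 3}
        - (∑ F₁ ∈ tJoins G Set.univ {a 0, a 1}, ∑ F₂ ∈ tJoins G Set.univ {a 2, a 3},
            if ∃ v : V, (SimpleGraph.fromEdgeSet (↑F₁ : Set (Sym2 V))).Reachable (a 0) v ∧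
                (SimpleGraph.fromEdgeSet (↑F₂ : Set (Sym2 V))).Reachable (a 2) v
            then Real.tanh β ^ (F₁.card + F₂.card) else 0)
        ≤ (∑ D ∈ (tJoins G Set.univ (Finset.univ.image a)).filter (fun D : Finset (Sym2 V) =>
            ¬ (SimpleGraph.fromEdgeSet (↑D : Set (Sym2 V))).Reachable (a 0) (a 2) ∧
            ¬ (SimpleGraph.fromEdgeSet (↑D : Set (Sym2 V))).Reachable (a 0) (a 3)),
            Real.tanh β ^ D.card) * loopO1PartitionFunction G (Real.tanh β) ∅ := by
  intro hDep hSplit V _ _ G _ β hβ a ha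
  exact StubSeparation.separation_core G hβ a
    (fun S h2 h3 => hDep V G β hβ (a 2) (a 3) S h2 h3) (hSplit V G β hβ a ha)

end Summit.CriticalPhenomena.Ising3DConformalLimit.Theorems

end
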